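import Literature.NumberTheory.LFunctions.MoebiusAutomaticFinalSync
import Literature.NumberTheory.LFunctions.AutomaticSequenceComponents
import HarnessLib

/-!
# Müllner's reduction: Prop. 3.2 (transducer estimate) ⇒ Thm. 1.2 (Möbius orthogonality of automatic sequences), proved

Everything in this file is PROVED. It formalises Proposition 3.3 of C. Müllner, *Automatic
sequences fulfill the Sarnak conjecture* (Duke Math. J. 166 (2017)), §3.1 — the reduction of
Theorem 1.2 (here: the named fact `Literature.NumberTheory.LFunctions.mullner_moebius_automatic`,
the case `ξ(n) = a_n`) to Proposition 3.2, an estimate for the naturally induced transducers of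
the final components — in full generality (arbitrary transducer group), with the hypothesis
Prop. 3.2 in the form `TransducerMoebiusEstimateSync` (regular representation, shift `r = 0`,
residues with a synchronized suffix — exactly what the reduction uses for the sequence itself;
implied by `TransducerMoebiusEstimate` of `AutomaticSequenceComponents.lean`):

* `isLittleO_moebiusSum_dfaoSeq_of_transducerEstimate` — for a finite DFAO `(σ, δ, q₀, τ)` read
  from the most significant digit with `δ(q₀, 0) = q₀`: if every strongly connected base-`k`
  automaton satisfies the transducer estimate, then `∑_{n ≤ N} a_n μ(n) = o(N)`;
* `mullner_moebius_automatic_of_transducerEstimate` — hence (kernel characterisation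
  `isAutomaticSeq_iff_exists_dfaoSeq`, normalisation `dfaoSeq_optionLift`) Prop. 3.2 implies
  `mullner_moebius_automatic`;
* `transducerMoebiusEstimate_of_minRank_eq_one` — non-vacuity/consistency: for transducers of
  rank `1` (synchronizing components, trivial group) the estimate holds unconditionally.

What remains unformalised of the printed proof is exactly the hypothesis: Prop. 3.2, proved in
the paper from Thm. 4.4 (the matrix-valued Mauduit–Rivat estimate), Thm. 4.5 (Fourier decay for
irreducible representations other than `D_ℓ`), Lemma 4.10 (carry property) and the structure
theorems Thm. 2.7 / Thm. 2.16; the part of Prop. 3.2 coming from the representations `D_ℓ`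
(`μ` in arithmetic progressions) is in the tree (`MoebiusAutomaticPeriodic.lean`).

Proof (Müllner §3.1, pp. 15–17). Pad `n ≤ N < k^ν` to `ν` digits (`δ(q₀,0) = q₀`). Fix the
first `λ₁` digits `b`: off `enterBad` (proportion `≤ η₁`, Lemma setDens) the state `p_b` after
`b` is in a final component `C`, a strongly connected automaton, and lies in a state `M_b` of its
naturally induced transducer (`exists_mem_minImages_mem`). Fix the last `λ₂` digits `m`: off
`syncBad` for the concatenation `W` of minimising words of all components (proportion `≤ η₂`),
the suffix contains the synchronizing word `w₀(C)` of the transducer, so the transducer state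
after the remaining digits `x` depends only on `(b, m)` (`next_eq_of_card_eq`), and by the
reconstruction Prop. 2.5 (`MinImage.wordAct_eq`) `a_n = Ψ_{b,m}(T(M_b, x))` for a function
`Ψ_{b,m}` on the group (`f_{w,b}` in the paper). Hence
`∑_{n ≤ N} a_n μ(n) = ∑_{b,m,π} Ψ_{b,m}(π) ∑_{n : prefix b, n ≡ m, T(M_b,x) = π} μ(n) + O(B(η₁k + 2η₂)N)`,
and each inner sum is `≤ ε₃ N` by the transducer estimate; there are at most
`k^{λ₁+λ₂} |σ|!` of them.

## References
* C. Müllner, Duke Math. J. 166 (2017), §3.1: Lemma setDens, Prop. 3.2, Prop. 3.3. [Mullner2017]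
-/

noncomputable section

open Finset Filter Asymptotics
open scoped ArithmeticFunction.Moebius

namespace Literature.NumberTheory.LFunctions

section Main

/-- Evaluation of the triple indicator sum defining the structured model (dependent version:
the third index ranges over a type depending on the first). [folklore] -/
theorem sum_sum_sum_mul_ite (GT GB : Finset ℕ) {ι : ℕ → Type} [∀ b, Fintype (ι b)]
    [∀ b, DecidableEq (ι b)] (Ψ : (b : ℕ) → ℕ → ι b → ℂ) (t : (b : ℕ) → ι b) (x y : ℕ) :
    ∑ b ∈ GT, ∑ r ∈ GB, ∑ π : ι b, Ψ b r π *
        ((if x = b then (1 : ℂ) else 0) * (if y = r then 1 else 0) * (if t b = π then 1 else 0)) =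
      if x ∈ GT ∧ y ∈ GB then Ψ x y (t x) else 0 := by
  have inner : ∀ b r, ∑ π : ι b, Ψ b r π *
      ((if x = b then (1 : ℂ) else 0) * (if y = r then 1 else 0) * (if t b = π then 1 else 0)) =
      Ψ b r (t b) * ((if x = b then (1 : ℂ) else 0) * (if y = r then 1 else 0)) := by
    intro b r
    have : ∀ π : ι b, Ψ b r π *
        ((if x = b then (1 : ℂ) else 0) * (if y = r then 1 else 0) * (if t b = π then 1 else 0)) =
        if t b = π then Ψ b r π * ((if x = b then (1 : ℂ) else 0) * (if y = r then 1 else 0))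
          else 0 := by
      intro π; split_ifs <;> ring
    rw [Finset.sum_congr rfl fun π _ => this π, Finset.sum_ite_eq]
    simp
  simp_rw [inner]
  exact sum_sum_mul_ite_ite GT GB (fun b r => Ψ b r (t b)) x y

/-- `n! ≤ |σ|!` for the rank of any transducer on (a subtype of) `σ`: `n₀ ≤ |σ'|`. [folklore] -/
theorem minRank_le_card {σ' : Type*} [Fintype σ'] [DecidableEq σ'] (δ' : σ' → ℕ → σ') :
    minRank δ' ≤ Fintype.card σ' :=
  (minRank_le_card_fullImage δ' []).trans (card_le_univ _)

/-- **Synchronized suffixes determine the transducer state** (Müllner §3.1: "for `[w₀]_k ∈ M_{λ₂}`,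
`w ∈ Σ*` it holds that `δ(q₀, w w₀) = δ(q₀, w₀)`", in the form used with the padded suffix): if the
block `(m)_k^{λ₂}` contains a minimising word `w₀` of the transducer, then for every `n ≡ m (k^{λ₂})`
and every `L ≥ λ₂` the state after the suffix `(n mod k^L)_k^L` is `δ(M, w₀ (m)_k^{λ₂})`,
independently of `n` and `L`. [cite: Mullner2017, §3.1] -/
theorem MinImage.next_msbBlock_eq_of_sync {σ' : Type*} [Fintype σ'] [DecidableEq σ'] {k : ℕ}
    (hk : 1 < k) {δ' : σ' → ℕ → σ'} (M : MinImage δ') {w₀ : List ℕ}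
    (hw₀ : (fullImage δ' w₀).card = minRank δ') {l2 m : ℕ} (hm : w₀ <:+: msbBlock k l2 m)
    {n : ℕ} (hn : n % k ^ l2 = m) {L : ℕ} (hL : l2 ≤ L) :
    M.next (msbBlock k L (n % k ^ L)) = M.next (w₀ ++ msbBlock k l2 m) := by
  have hk0 : 0 < k := by omega
  obtain ⟨mid, rfl⟩ : ∃ mid, L = mid + l2 := ⟨L - l2, by omega⟩
  have hKpos : 0 < k ^ l2 := pow_pos hk0 _
  have hR : n % k ^ (mid + l2) < k ^ (mid + l2) := Nat.mod_lt _ (pow_pos hk0 _)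
  have hMid : n % k ^ (mid + l2) / k ^ l2 < k ^ mid := by
    rw [Nat.div_lt_iff_lt_mul hKpos, ← pow_add]; exact hR
  have hBt : n % k ^ (mid + l2) % k ^ l2 = m := by
    rw [Nat.mod_mod_of_dvd n (pow_dvd_pow k (Nat.le_add_left l2 mid)), hn]
  have hsplit : msbBlock k (mid + l2) (n % k ^ (mid + l2)) =
      msbBlock k mid (n % k ^ (mid + l2) / k ^ l2) ++ msbBlock k l2 m := by
    conv_lhs => rw [← Nat.div_add_mod (n % k ^ (mid + l2)) (k ^ l2), hBt]
    exact msbBlock_add hk hMid (hBt ▸ Nat.mod_lt _ hKpos)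
  obtain ⟨y, v, hyv⟩ := hm
  have e1 : M.next (msbBlock k (mid + l2) (n % k ^ (mid + l2))) =
      ((M.next (msbBlock k mid (n % k ^ (mid + l2) / k ^ l2) ++ y)).next w₀).next v := by
    rw [← MinImage.next_append, ← MinImage.next_append, hsplit, ← hyv]
    congr 1
    simp [List.append_assoc]
  have e2 : M.next (w₀ ++ msbBlock k l2 m) = ((M.next (w₀ ++ y)).next w₀).next v := by
    rw [← MinImage.next_append, ← MinImage.next_append, ← hyv]
    congr 1
    simp [List.append_assoc]
  rw [e1, e2, MinImage.next_eq_of_card_eq (M.next (msbBlock k mid (n % k ^ (mid + l2) / k ^ l2) ++ y))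
    (M.next (w₀ ++ y)) hw₀]

/-- **Müllner's Proposition 3.2 restricted to synchronized suffixes** — the part of
`TransducerMoebiusEstimate` that the reduction Prop. 3.3 actually uses: the bound is only required
for residues `m` whose block `(m)_k^{λ₂}` contains a synchronizing (= minimising) word of the
transducer, so that the transducer state after the suffix is determined by `m` (Müllner §3.1:
"`M_{λ₂}` … the set of integers `m` such that `(m)_k^{λ₂}` is a synchronizing word of `T_A`"). For
such `m` the property does not depend on the chosen enumerations of the minimal images (a
relabelling, Prop. 2.6, conjugates `T(M, ·)` by fixed permutations). A property with parameters,
not asserted here.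

DELTAS against Prop. 3.2 as printed (arXiv:1602.03042 p. 15), to be checked by whoever later cites
a proof of it: (i) shift `r = 0` only (the paper is uniform in `r`; only `r = 0` is needed for
`ξ(n) = a_n`); (ii) the indicator `[T(M, ·) = π]` (matrix coefficients of the REGULAR representation)
instead of `‖Σ … D(T(·)) μ‖_F` for each unitary irreducible `D` (equivalent for a finite group);
(iii) the output is read from an ARBITRARY transducer state `M` along the padded low block
`(n mod k^{ν−λ₁})_k^{ν−λ₁}`, where the paper reads the full word `(n+r)_k` from the initial state
and then factors off `T(q₀,(b)_k)` (§3.1, the step from `S₂` to `S₃`) — the same sums up to a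
fixed left factor; (iv) `b = 0` and the top range `n ≤ N` are allowed (paper: `0 < b`, `n < N`),
a harmless enlargement; (v) only residues `m` with a synchronized suffix (weaker than the paper's
all `m < k^{λ₂}`). [cite: Mullner2017, Prop. 3.2] -/
def TransducerMoebiusEstimateSync {σ' : Type*} [Fintype σ'] [DecidableEq σ'] (k : ℕ)
    (δ' : σ' → ℕ → σ') (M : MinImage δ') (π : Equiv.Perm (Fin (minRank δ'))) (l1 l2 : ℕ) : Prop :=
  ∀ ε : ℝ, 0 < ε → ∃ N₀ : ℕ, ∀ N : ℕ, N₀ ≤ N → ∀ b m : ℕ,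
    (∃ w₀ : List ℕ, (fullImage δ' w₀).card = minRank δ' ∧ w₀ <:+: msbBlock k l2 m) →
    ‖∑ n ∈ (Finset.range (N + 1)).filter (fun n =>
        n / k ^ ((Nat.digits k N).length - l1) = b ∧ n % k ^ l2 = m ∧
          M.T (msbBlock k ((Nat.digits k N).length - l1)
            (n % k ^ ((Nat.digits k N).length - l1))) = π),
      (μ n : ℂ)‖ ≤ ε * N

/-- The full estimate implies the synchronized one. [folklore] -/
theorem TransducerMoebiusEstimate.sync {σ' : Type*} [Fintype σ'] [DecidableEq σ'] {k : ℕ}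
    {δ' : σ' → ℕ → σ'} {M : MinImage δ'} {π : Equiv.Perm (Fin (minRank δ'))} {l1 l2 : ℕ}
    (h : TransducerMoebiusEstimate k δ' M π l1 l2) : TransducerMoebiusEstimateSync k δ' M π l1 l2 :=
  fun ε hε => (h ε hε).imp fun _ hN N hNle b m _ => hN N hNle b m

/-- **Müllner 2017, Proposition 3.3 (`Prop. 3.2 ⇒ Thm. 1.2`), for the sequence itself**,
normalised form `δ(q₀, 0) = q₀`: if every strongly connected base-`k` automaton satisfies the
transducer estimate `TransducerMoebiusEstimateSync` (Prop. 3.2 for the regular representation,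
residues with synchronized suffix), then
the sequence generated by any finite DFAO read from the most significant digit is orthogonal to
`μ`. See the module docstring for the proof. This primed version asks the transducer estimate
only for the FINAL COMPONENTS of the given automaton (all that the proof uses; it allows one to
pass to a power base first, Prop. 2.25). [cite: Mullner2017, Prop. 3.3] -/
theorem isLittleO_moebiusSum_dfaoSeq_of_transducerEstimate' {σ : Type} [Fintype σ] [DecidableEq σ]
    {k : ℕ} (hk : 2 ≤ k) (δ₀ : σ → ℕ → σ) (q₀ : σ) (τ : σ → ℂ) (h0 : δ₀ q₀ 0 = q₀)
    (H : ∀ p : σ, p ∈ finalStates (digitRestrict k δ₀) →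
      ∀ (M : MinImage (restrictδ (digitRestrict k δ₀) (reach (digitRestrict k δ₀) p)
          (reach_closed (digitRestrict k δ₀) p)))
        (π : Equiv.Perm (Fin (minRank (restrictδ (digitRestrict k δ₀) (reach (digitRestrict k δ₀) p)
          (reach_closed (digitRestrict k δ₀) p))))) (l1 l2 : ℕ),
        TransducerMoebiusEstimateSync k (restrictδ (digitRestrict k δ₀) (reach (digitRestrict k δ₀) p)
          (reach_closed (digitRestrict k δ₀) p)) M π l1 l2) :
    moebiusSum (dfaoSeq k δ₀ q₀ τ) =o[atTop] fun N : ℕ => (N : ℝ) := by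
  have hk1 : 1 < k := hk
  have hk0 : 0 < k := by omega
  -- pass to the digit-restricted automaton `δ`
  set δ := digitRestrict k δ₀ with hδ
  have hδtriv : ∀ q d, k ≤ d → δ q d = q := digitRestrict_trivial k δ₀
  have h0' : δ q₀ 0 = q₀ := by rw [hδ, digitRestrict_of_lt δ₀ q₀ hk0]; exact h0
  rw [← dfaoSeq_digitRestrict hk δ₀ q₀ τ]
  -- the final states
  set F : Set σ := ↑(finalStates δ) with hF_def
  have hF : ∀ q ∈ F, ∀ d, d < k → δ q d ∈ F := fun q hq d _ => by
    rw [hF_def, mem_coe] at hq ⊢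
    exact finalStates_closed hq d
  have hreach : ∀ q : σ, ∃ u : List ℕ, (∀ d ∈ u, d < k) ∧ u.foldl δ q ∈ F := by
    intro q
    obtain ⟨u, hu⟩ := exists_wordAct_mem_finalStates δ q
    refine ⟨u.filter (· < k), fun d hd => mem_filter_lt hd, ?_⟩
    rw [hF_def, mem_coe, ← wordAct_def, ← wordAct_filter_of_trivial hδtriv]
    exact hu
  -- the components and their transducers
  let δC : (p : σ) → ↥(reach δ p) → ℕ → ↥(reach δ p) :=
    fun p => restrictδ δ (reach δ p) (reach_closed δ p)
  have hCtriv : ∀ p (q : ↥(reach δ p)) d, k ≤ d → δC p q d = q :=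
    fun p q d hd => Subtype.ext (hδtriv _ _ hd)
  have hw₀ : ∀ p : σ, ∃ w : List ℕ, (∀ d ∈ w, d < k) ∧
      (fullImage (δC p) w).card = minRank (δC p) := by
    intro p
    obtain ⟨w, hw⟩ := exists_card_fullImage_eq_minRank (δC p)
    refine ⟨w.filter (· < k), fun d hd => mem_filter_lt hd, ?_⟩
    rw [← hw, fullImage, fullImage]
    congr 1
    exact image_congr fun q _ => (wordAct_filter_of_trivial (hCtriv p) w q).symm
  choose w₀ hw₀d hw₀c using hw₀
  have hM : ∀ p : ↥(finalStates δ), ∃ M : MinImage (δC p),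
      (⟨p.1, self_mem_reach δ p.1⟩ : ↥(reach δ p.1)) ∈ M.1 := by
    intro p
    obtain ⟨M, hM, hpM⟩ := exists_mem_minImages_mem
      (isStronglyConnected_restrict_reach (δ := δ) p.2) ⟨p.1, self_mem_reach δ p.1⟩
    exact ⟨⟨M, hM⟩, hpM⟩
  choose Mst hMst using hM
  -- the concatenated synchronizing word
  set W : List ℕ := ((finalStates δ).toList.map w₀).flatten with hW_def
  have hW : ∀ d ∈ W, d < k := by
    intro d hd
    rw [hW_def, List.mem_flatten] at hd
    obtain ⟨l, hl, hdl⟩ := hd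
    obtain ⟨p, -, rfl⟩ := List.mem_map.1 hl
    exact hw₀d p d hdl
  have hW₀ : ∀ p ∈ finalStates δ, w₀ p <:+: W := fun p hp =>
    List.infix_of_mem_flatten (List.mem_map.2 ⟨p, mem_toList.2 hp, rfl⟩)
  -- bounds for the values and the group sizes
  set B : ℝ := 1 + ∑ q, ‖τ q‖
  have hB0 : 0 < B := by
    have : 0 ≤ ∑ q, ‖τ q‖ := sum_nonneg fun _ _ => norm_nonneg _
    linarith
  have hτ : ∀ q, ‖τ q‖ ≤ B := fun q =>
    (single_le_sum (f := fun q => ‖τ q‖) (fun _ _ => norm_nonneg _) (mem_univ q)).trans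
      (by linarith)
  set a := dfaoSeq k δ q₀ τ with ha_def
  have ha : ∀ n, ‖a n‖ ≤ B := fun n => hτ _
  set P : ℕ := (Fintype.card σ).factorial with hP
  have hP1 : 1 ≤ P := Nat.one_le_iff_ne_zero.2 (Nat.factorial_ne_zero _)
  have hPR : (1 : ℝ) ≤ P := by exact_mod_cast hP1
  have hPerm : ∀ p : σ, Fintype.card (Equiv.Perm (Fin (minRank (δC p)))) ≤ P := by
    intro p
    rw [Fintype.card_perm, Fintype.card_fin, hP]
    exact Nat.factorial_le ((minRank_le_card (δC p)).trans
      (by rw [Fintype.card_coe]; exact card_le_univ _))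
  rw [isLittleO_iff]
  intro ε hε
  have hkR : (0 : ℝ) < k := by exact_mod_cast hk0
  -- the levels `λ₁`, `λ₂`
  obtain ⟨mlen, hm⟩ := exists_uniform_enter hk1.le hF hreach
  obtain ⟨l1, hl1⟩ := exists_card_le_of_card_mul_le hk1 (S := fun L => enterBad k δ q₀ F L)
    (card_enterBad_mul_le hk1 hF hm) (η := ε / (8 * B * k)) (by positivity)
  obtain ⟨l2, hl2⟩ := exists_card_syncBad_le hk1 hW (η := ε / (16 * B)) (by positivity)
  set K1 := k ^ l1 with hK1
  set K2 := k ^ l2 with hK2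
  have hK1pos : 0 < K1 := pow_pos hk0 _
  have hK2pos : 0 < K2 := pow_pos hk0 _
  have hK1R : (0 : ℝ) < K1 := by exact_mod_cast hK1pos
  have hK2R : (0 : ℝ) < K2 := by exact_mod_cast hK2pos
  -- the state after the prefix `b`, and the thresholds from the transducer estimate
  set pst : ℕ → σ := fun b => (msbBlock k l1 b).foldl δ q₀ with hpst
  set ε₃ : ℝ := ε / (8 * B * K1 * K2 * P) with hε₃
  have hε₃pos : 0 < ε₃ := by positivity
  have HN : ∀ b : ℕ, ∃ Nb : ℕ, ∀ (h : pst b ∈ finalStates δ)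
      (π : Equiv.Perm (Fin (minRank (δC (pst b))))), ∀ N : ℕ, Nb ≤ N → ∀ m : ℕ,
      (∃ w : List ℕ, (fullImage (δC (pst b)) w).card = minRank (δC (pst b)) ∧
        w <:+: msbBlock k l2 m) →
      ‖∑ n ∈ (range (N + 1)).filter (fun n =>
          n / k ^ ((Nat.digits k N).length - l1) = b ∧ n % k ^ l2 = m ∧
            (Mst ⟨pst b, h⟩).T (msbBlock k ((Nat.digits k N).length - l1)
              (n % k ^ ((Nat.digits k N).length - l1))) = π),
        (μ n : ℂ)‖ ≤ ε₃ * N := by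
    intro b
    by_cases h : pst b ∈ finalStates δ
    · choose Nπ hNπ using fun π : Equiv.Perm (Fin (minRank (δC (pst b)))) =>
        H (pst b) h (Mst ⟨pst b, h⟩) π l1 l2 ε₃ hε₃pos
      refine ⟨univ.sup Nπ, fun h' π N hN m hm => ?_⟩
      exact hNπ π N ((le_sup (f := Nπ) (mem_univ π)).trans hN) b m hm
    · exact ⟨0, fun h' => absurd h' h⟩
  choose Nb hNb using HN
  refine eventually_atTop.2 ⟨max ((range K1).sup Nb) (k ^ (l1 + l2)), fun N hN => ?_⟩
  have hN3 : ∀ b, b < K1 → Nb b ≤ N := fun b hb =>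
    ((le_sup (f := Nb) (mem_range.2 hb)).trans (le_max_left _ _)).trans hN
  have hNpow : k ^ (l1 + l2) ≤ N := (le_max_right _ _).trans hN
  have hNpos : 0 < N := lt_of_lt_of_le (pow_pos hk0 _) hNpow
  have hK2N : K2 ≤ N := (Nat.pow_le_pow_right hk0 (Nat.le_add_left l2 l1)).trans hNpow
  rw [Real.norm_natCast]
  -- `ν` digits
  set ν := (Nat.digits k N).length with hν
  have hNν : N < k ^ ν := Nat.lt_base_pow_length_digits hk1
  have hνN : k ^ ν ≤ k * N := Nat.base_pow_length_digits_le k N hk1 hNpos.ne'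
  have hl12 : l1 + l2 ≤ ν :=
    ((Nat.pow_lt_pow_iff_right hk1).1 (lt_of_le_of_lt hNpow hNν)).le
  set D := k ^ (ν - l1) with hD
  have hDpos : 0 < D := pow_pos hk0 _
  have hK1D : (K1 : ℝ) * D ≤ k * N := by
    have : K1 * D = k ^ ν := by rw [hK1, hD, ← pow_add]; congr 1; omega
    exact_mod_cast this.le.trans hνN
  -- the remaining digits after the prefix, as a word
  set xw : ℕ → List ℕ := fun n => msbBlock k (ν - l1) (n % D) with hxw
  -- the functions `Ψ_{b,m}` on the groups, and the group elements
  set Ψ : (b : ℕ) → ℕ → Equiv.Perm (Fin (minRank (δC (pst b)))) → ℂ := fun b m π =>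
    if h : pst b ∈ finalStates δ then
      τ ((((Mst ⟨pst b, h⟩).next (w₀ (pst b) ++ msbBlock k l2 m)).enum.symm
        (π ((Mst ⟨pst b, h⟩).enum ⟨⟨pst b, self_mem_reach δ (pst b)⟩, hMst ⟨pst b, h⟩⟩)) :
          ↥(reach δ (pst b))) : σ)
    else 0 with hΨ
  have hΨB : ∀ b m π, ‖Ψ b m π‖ ≤ B := by
    intro b m π
    simp only [hΨ]
    split_ifs
    · exact hτ _
    · rw [norm_zero]; exact hB0.le
  have hΨ_eval : ∀ b m π (h : pst b ∈ finalStates δ), Ψ b m π =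
      τ ((((Mst ⟨pst b, h⟩).next (w₀ (pst b) ++ msbBlock k l2 m)).enum.symm
        (π ((Mst ⟨pst b, h⟩).enum ⟨⟨pst b, self_mem_reach δ (pst b)⟩, hMst ⟨pst b, h⟩⟩)) :
          ↥(reach δ (pst b))) : σ) := by
    intro b m π h
    simp only [hΨ, dif_pos h]
  set TT : (b : ℕ) → ℕ → Equiv.Perm (Fin (minRank (δC (pst b)))) := fun b n =>
    if h : pst b ∈ finalStates δ then (Mst ⟨pst b, h⟩).T (xw n) else 1 with hTT
  -- (0) the key identity (Müllner §3.1: reconstruction after synchronisation)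
  have key : ∀ n, n < k ^ ν → ∀ (p : σ) (hp : pst (n / D) = p) (h : p ∈ finalStates δ),
      n % K2 ∉ syncBad k l2 W → a n =
        τ (((((Mst ⟨p, h⟩).next (w₀ p ++ msbBlock k l2 (n % K2))).enum.symm
          ((Mst ⟨p, h⟩).T (xw n) ((Mst ⟨p, h⟩).enum ⟨⟨p, self_mem_reach δ p⟩, hMst ⟨p, h⟩⟩))) :
            ↥(reach δ p)) : σ) := by
    intro n hnν p hp h hgood
    -- split the padded word
    obtain ⟨mid, hmid⟩ : ∃ mid, ν - l1 = mid + l2 ∧ ν = l1 + (mid + l2) :=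
      ⟨ν - l1 - l2, by omega, by omega⟩
    have hT : n / D < K1 := by
      rw [Nat.div_lt_iff_lt_mul hDpos, hK1, hD, ← pow_add]
      calc n < k ^ ν := hnν
        _ = k ^ (l1 + (ν - l1)) := by congr 1; omega
    have hR : n % D < D := Nat.mod_lt _ hDpos
    have hsplit1 : msbBlock k ν n = msbBlock k l1 (n / D) ++ xw n := by
      have h1 : n = D * (n / D) + n % D := (Nat.div_add_mod n D).symm
      conv_lhs => rw [show ν = l1 + (ν - l1) by omega, h1]
      exact msbBlock_add hk1 hT hR
    have hK2dvd : K2 ∣ D := by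
      rw [hK2, hD]; exact pow_dvd_pow k (by omega)
    have hBt : n % D % K2 = n % K2 := Nat.mod_mod_of_dvd n hK2dvd
    have hMid : n % D / K2 < k ^ mid := by
      rw [Nat.div_lt_iff_lt_mul hK2pos, hK2, ← pow_add, ← hmid.1]; exact hR
    have hsplit2 : xw n = msbBlock k mid (n % D / K2) ++ msbBlock k l2 (n % K2) := by
      simp only [hxw]
      have h2 : n % D = K2 * (n % D / K2) + n % D % K2 := (Nat.div_add_mod _ _).symm
      conv_lhs => rw [hmid.1, h2, hBt]
      exact msbBlock_add hk1 hMid (Nat.mod_lt _ hK2pos)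
    -- the suffix contains the synchronizing word of the component of `p`
    have hwinf : w₀ p <:+: msbBlock k l2 (n % K2) := by
      have hWinf : W <:+: msbBlock k l2 (n % K2) := by
        by_contra hc
        exact hgood (mem_syncBad.2 ⟨Nat.mod_lt _ hK2pos, hc⟩)
      exact (hW₀ p h).trans hWinf
    obtain ⟨y, v, hyv⟩ := hwinf
    -- (a) reading: `a n = τ(wordAct δ (xw n) p)`
    have hread : a n = τ (wordAct δ (xw n) p) := by
      rw [ha_def, dfaoSeq_eq_of_fix_zero h0' k ν, ← wordAct_def, hsplit1, wordAct_append, ← hp,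
        hpst]
      rfl
    -- (b) inside the component, through the transducer (Prop. 2.5)
    have hcomp : wordAct δ (xw n) p =
        ((((Mst ⟨p, h⟩).next (xw n)).enum.symm ((Mst ⟨p, h⟩).T (xw n)
          ((Mst ⟨p, h⟩).enum ⟨⟨p, self_mem_reach δ p⟩, hMst ⟨p, h⟩⟩)) : ↥(reach δ p)) : σ) := by
      rw [← MinImage.wordAct_eq, coe_wordAct_restrictδ]
    -- (c) synchronisation: the transducer state after `xw n` only depends on `m`
    have e1 : (Mst ⟨p, h⟩).next (xw n) =
        (((Mst ⟨p, h⟩).next (msbBlock k mid (n % D / K2) ++ y)).next (w₀ p)).next v := by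
      rw [← MinImage.next_append, ← MinImage.next_append, hsplit2, ← hyv]
      congr 1
      simp [List.append_assoc]
    have e2 : (Mst ⟨p, h⟩).next (w₀ p ++ msbBlock k l2 (n % K2)) =
        (((Mst ⟨p, h⟩).next (w₀ p ++ y)).next (w₀ p)).next v := by
      rw [← MinImage.next_append, ← MinImage.next_append, ← hyv]
      congr 1
      simp [List.append_assoc]
    have hsync : (Mst ⟨p, h⟩).next (xw n) = (Mst ⟨p, h⟩).next (w₀ p ++ msbBlock k l2 (n % K2)) := by
      rw [e1, e2, MinImage.next_eq_of_card_eq ((Mst ⟨p, h⟩).next (msbBlock k mid (n % D / K2) ++ y))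
        ((Mst ⟨p, h⟩).next (w₀ p ++ y)) (hw₀c p)]
    rw [hread, hcomp, MinImage.coe_enum_symm_congr hsync]
  -- the structured model
  set GT := (range K1).filter fun b => b ∉ enterBad k δ q₀ F l1 with hGT
  set GB := (range K2).filter fun r => r ∉ syncBad k l2 W with hGB
  set c : ℕ → ℂ := fun n => ∑ b ∈ GT, ∑ r ∈ GB, ∑ π : Equiv.Perm (Fin (minRank (δC (pst b)))),
    Ψ b r π * ((if n / D = b then (1 : ℂ) else 0) * (if n % K2 = r then 1 else 0) *
      (if TT b n = π then 1 else 0)) with hc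
  have hc_eval : ∀ n, c n =
      if n / D ∈ GT ∧ n % K2 ∈ GB then Ψ (n / D) (n % K2) (TT (n / D) n) else 0 :=
    fun n => sum_sum_sum_mul_ite GT GB Ψ (fun b => TT b n) (n / D) (n % K2)
  -- (1) pointwise comparison for `n ≤ N`
  have hptwise : ∀ n, n < N + 1 → ‖a n - c n‖ ≤
      (if n / D ∈ enterBad k δ q₀ F l1 then B else 0) +
        (if n % K2 ∈ syncBad k l2 W then B else 0) := by
    intro n hn
    have hnν : n < k ^ ν := lt_of_le_of_lt (Nat.le_of_lt_succ hn) hNν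
    have hnD : n / D < K1 := by
      rw [Nat.div_lt_iff_lt_mul hDpos, hK1, hD, ← pow_add]
      calc n < k ^ ν := hnν
        _ = k ^ (l1 + (ν - l1)) := by congr 1; omega
    by_cases h1 : n / D ∈ enterBad k δ q₀ F l1
    · rw [if_pos h1]
      have : c n = 0 := by
        rw [hc_eval, if_neg]
        rintro ⟨hT, -⟩
        exact (mem_filter.1 hT).2 h1
      rw [this, sub_zero]
      have : 0 ≤ (if n % K2 ∈ syncBad k l2 W then B else 0) := by split_ifs <;> linarith
      linarith [ha n]
    · rw [if_neg h1, zero_add]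
      by_cases h2 : n % K2 ∈ syncBad k l2 W
      · rw [if_pos h2]
        have : c n = 0 := by
          rw [hc_eval, if_neg]
          rintro ⟨-, hB'⟩
          exact (mem_filter.1 hB').2 h2
        rw [this, sub_zero]
        exact ha n
      · rw [if_neg h2]
        have hfin : pst (n / D) ∈ finalStates δ := by
          by_contra hc'
          exact h1 (mem_enterBad.2 ⟨hnD, by rwa [hF_def, mem_coe]⟩)
        have hcn : c n = Ψ (n / D) (n % K2) (TT (n / D) n) := by
          rw [hc_eval, if_pos]
          exact ⟨mem_filter.2 ⟨mem_range.2 hnD, h1⟩,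
            mem_filter.2 ⟨mem_range.2 (Nat.mod_lt _ hK2pos), h2⟩⟩
        have hTT' : TT (n / D) n = (Mst ⟨pst (n / D), hfin⟩).T (xw n) := by
          simp only [hTT, dif_pos hfin]
        rw [hcn, hTT', hΨ_eval _ _ _ hfin, ← key n hnν (pst (n / D)) rfl hfin h2, sub_self, norm_zero]
  -- (2) the `L¹` error
  have hL1 : ∑ n ∈ range (N + 1), ‖a n - c n‖ ≤ ε / 4 * N := by
    calc ∑ n ∈ range (N + 1), ‖a n - c n‖
        ≤ ∑ n ∈ range (N + 1), ((if n / D ∈ enterBad k δ q₀ F l1 then B else 0) +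
            (if n % K2 ∈ syncBad k l2 W then B else 0)) :=
          sum_le_sum fun n hn => hptwise n (mem_range.1 hn)
      _ = B * ((range (N + 1)).filter fun n => n / D ∈ enterBad k δ q₀ F l1).card +
            B * ((range (N + 1)).filter fun n => n % K2 ∈ syncBad k l2 W).card := by
          rw [sum_add_distrib, ← sum_filter, ← sum_filter, sum_const, sum_const, nsmul_eq_mul,
            nsmul_eq_mul, mul_comm _ B, mul_comm _ B]
      _ ≤ B * ((enterBad k δ q₀ F l1).card * D) +
            B * ((N / K2 + 1 : ℕ) * (syncBad k l2 W).card) := by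
          gcongr
          · exact_mod_cast card_filter_div_mem_le D hDpos _ N
          · exact_mod_cast card_filter_mod_mem_le K2 _ N
      _ ≤ B * (ε / (8 * B * k) * K1 * D) + B * ((N / K2 + 1 : ℕ) * (ε / (16 * B) * K2)) := by
          have hl1' : ((enterBad k δ q₀ F l1).card : ℝ) ≤ ε / (8 * B * k) * (K1 : ℝ) := by
            rw [hK1]; push_cast; exact hl1
          have hl2' : ((syncBad k l2 W).card : ℝ) ≤ ε / (16 * B) * (K2 : ℝ) := by
            rw [hK2]; push_cast; exact hl2
          gcongr
      _ ≤ ε / 4 * N := by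
          have h1 : B * (ε / (8 * B * k) * K1 * D) ≤ ε / 8 * N := by
            have : B * (ε / (8 * B * k) * K1 * D) = ε / 8 * ((K1 : ℝ) * D / k) := by
              field_simp
            rw [this]
            gcongr
            rw [div_le_iff₀ hkR, mul_comm (N : ℝ)]
            exact hK1D
          have h2 : B * (((N / K2 + 1 : ℕ) : ℝ) * (ε / (16 * B) * K2)) ≤ ε / 8 * N := by
            have hq : ((N / K2 + 1 : ℕ) : ℝ) * K2 ≤ 2 * N := by
              have h' : (N / K2 + 1) * K2 ≤ 2 * N := by
                calc (N / K2 + 1) * K2 = N / K2 * K2 + K2 := by ring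
                  _ ≤ N + N := add_le_add (Nat.div_mul_le_self N K2) hK2N
                  _ = 2 * N := by ring
              exact_mod_cast h'
            calc B * (((N / K2 + 1 : ℕ) : ℝ) * (ε / (16 * B) * K2))
                = ε / 16 * ((((N / K2 + 1 : ℕ) : ℝ)) * K2) := by field_simp
              _ ≤ ε / 16 * (2 * N) := by gcongr
              _ = ε / 8 * N := by ring
          linarith
  -- (3) the structured part: the transducer estimate
  have hMc : ‖moebiusSum c N‖ ≤ ε / 8 * N := by
    have hexp : moebiusSum c N = ∑ b ∈ GT, ∑ r ∈ GB,
        ∑ π : Equiv.Perm (Fin (minRank (δC (pst b)))), Ψ b r π *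
          ∑ n ∈ (range (N + 1)).filter (fun n => n / D = b ∧ n % K2 = r ∧ TT b n = π),
            (μ n : ℂ) := by
      rw [hc, moebiusSum_finset_sum]
      refine sum_congr rfl fun b _ => ?_
      rw [moebiusSum_finset_sum]
      refine sum_congr rfl fun r _ => ?_
      rw [moebiusSum_finset_sum]
      refine sum_congr rfl fun π _ => ?_
      rw [moebiusSum_const_mul, moebiusSum, sum_filter]
      congr 1
      refine sum_congr rfl fun n _ => ?_
      by_cases h1 : n / D = b <;> by_cases h2 : n % K2 = r <;> by_cases h3 : TT b n = π <;>
        simp [h1, h2, h3]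
    rw [hexp]
    calc ‖∑ b ∈ GT, ∑ r ∈ GB, ∑ π : Equiv.Perm (Fin (minRank (δC (pst b)))), Ψ b r π *
          ∑ n ∈ (range (N + 1)).filter (fun n => n / D = b ∧ n % K2 = r ∧ TT b n = π),
            (μ n : ℂ)‖
        ≤ ∑ b ∈ GT, ∑ r ∈ GB, ∑ _π : Equiv.Perm (Fin (minRank (δC (pst b)))),
            B * (ε₃ * N) := by
          refine (norm_sum_le _ _).trans (sum_le_sum fun b hb => ?_)
          refine (norm_sum_le _ _).trans (sum_le_sum fun r hr => ?_)
          refine (norm_sum_le _ _).trans (sum_le_sum fun π _ => ?_)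
          rw [norm_mul]
          refine mul_le_mul (hΨB b r π) ?_ (norm_nonneg _) hB0.le
          -- `b ∈ GT`: the state after `b` is final, and the estimate applies
          have hbK : b < K1 := mem_range.1 (mem_filter.1 hb).1
          have hfin : pst b ∈ finalStates δ := by
            by_contra hc'
            exact (mem_filter.1 hb).2 (mem_enterBad.2 ⟨hbK, by rwa [hF_def, mem_coe]⟩)
          have hTTb : ∀ n, TT b n = (Mst ⟨pst b, hfin⟩).T (xw n) := fun n => by
            simp only [hTT, dif_pos hfin]
          have hrsync : ∃ w : List ℕ, (fullImage (δC (pst b)) w).card = minRank (δC (pst b)) ∧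
              w <:+: msbBlock k l2 r := by
            refine ⟨w₀ (pst b), hw₀c (pst b), (hW₀ _ hfin).trans ?_⟩
            by_contra hc'
            exact (mem_filter.1 hr).2 (mem_syncBad.2 ⟨mem_range.1 (mem_filter.1 hr).1, hc'⟩)
          have := hNb b hfin π N (hN3 b hbK) r hrsync
          simp only [hTTb]
          exact this
      _ = ∑ b ∈ GT, (GB.card : ℝ) *
            ((Fintype.card (Equiv.Perm (Fin (minRank (δC (pst b))))) : ℝ) * (B * (ε₃ * N))) := by
          refine sum_congr rfl fun b _ => ?_
          rw [sum_const, nsmul_eq_mul, sum_const, card_univ, nsmul_eq_mul]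
      _ ≤ ∑ _b ∈ GT, (K2 : ℝ) * (P * (B * (ε₃ * N))) := by
          refine sum_le_sum fun b _ => ?_
          have hGB : (GB.card : ℝ) ≤ K2 := by
            exact_mod_cast (card_filter_le _ _).trans_eq (card_range K2)
          have hε₃N : 0 ≤ B * (ε₃ * N) := by positivity
          gcongr
          exact hPerm (pst b)
      _ = (GT.card : ℝ) * ((K2 : ℝ) * (P * (B * (ε₃ * N)))) := by rw [sum_const, nsmul_eq_mul]
      _ ≤ (K1 : ℝ) * ((K2 : ℝ) * (P * (B * (ε₃ * N)))) := by
          have hGT : (GT.card : ℝ) ≤ K1 := by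
            exact_mod_cast (card_filter_le _ _).trans_eq (card_range K1)
          have : 0 ≤ (K2 : ℝ) * (P * (B * (ε₃ * N))) := by positivity
          gcongr
      _ = ε / 8 * N := by rw [hε₃]; field_simp
  -- conclusion
  calc ‖moebiusSum a N‖ = ‖(moebiusSum a N - moebiusSum c N) + moebiusSum c N‖ := by
        rw [sub_add_cancel]
    _ ≤ ‖moebiusSum a N - moebiusSum c N‖ + ‖moebiusSum c N‖ := norm_add_le _ _
    _ ≤ ε / 4 * N + ε / 8 * N := add_le_add ((norm_moebiusSum_sub_le a c N).trans hL1) hMc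
    _ ≤ ε * N := by
        have : (0 : ℝ) ≤ N := Nat.cast_nonneg N
        nlinarith

/-- **Müllner 2017, Prop. 3.3 for one DFAO** with the hypothesis for ALL strongly connected
base-`k` automata (the original form; a corollary of the component-wise
`isLittleO_moebiusSum_dfaoSeq_of_transducerEstimate'`). [cite: Mullner2017, Prop. 3.3] -/
theorem isLittleO_moebiusSum_dfaoSeq_of_transducerEstimate {σ : Type} [Fintype σ] [DecidableEq σ]
    {k : ℕ} (hk : 2 ≤ k) (δ₀ : σ → ℕ → σ) (q₀ : σ) (τ : σ → ℂ) (h0 : δ₀ q₀ 0 = q₀)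
    (H : ∀ (σ' : Type) [Fintype σ'] [DecidableEq σ'] (δ' : σ' → ℕ → σ'),
      IsStronglyConnected δ' → (∀ q d, k ≤ d → δ' q d = q) →
      ∀ (M : MinImage δ') (π : Equiv.Perm (Fin (minRank δ'))) (l1 l2 : ℕ),
        TransducerMoebiusEstimateSync k δ' M π l1 l2) :
    moebiusSum (dfaoSeq k δ₀ q₀ τ) =o[atTop] fun N : ℕ => (N : ℝ) :=
  isLittleO_moebiusSum_dfaoSeq_of_transducerEstimate' hk δ₀ q₀ τ h0 fun _ hp M π l1 l2 =>
    H _ _ (isStronglyConnected_restrict_reach hp)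
      (fun _ _ hd => Subtype.ext (digitRestrict_trivial k δ₀ _ _ hd)) M π l1 l2

/-- **Müllner 2017, Prop. 3.3: Proposition 3.2 implies Theorem 1.2** (for `ξ(n) = a_n`, i.e. the
named fact `mullner_moebius_automatic`): if every strongly connected base-`k` automaton satisfies
the transducer estimate of Prop. 3.2 (`TransducerMoebiusEstimateSync`, regular representation,
shift `0`, synchronized suffixes), then every `k`-automatic sequence (`k ≥ 2`, finite `k`-kernel) is orthogonal to `μ`.
Assembled from the kernel characterisation (`isAutomaticSeq_iff_exists_dfaoSeq`, A–S 6.6.2), the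
normalisation `δ(q₀,0) = q₀` (`dfaoSeq_optionLift`) and
`isLittleO_moebiusSum_dfaoSeq_of_transducerEstimate`. [cite: Mullner2017, Prop. 3.3] -/
theorem mullner_moebius_automatic_of_transducerEstimate
    (H : ∀ (k : ℕ), 2 ≤ k → ∀ (σ' : Type) [Fintype σ'] [DecidableEq σ'] (δ' : σ' → ℕ → σ'),
      IsStronglyConnected δ' → (∀ q d, k ≤ d → δ' q d = q) →
      ∀ (M : MinImage δ') (π : Equiv.Perm (Fin (minRank δ'))) (l1 l2 : ℕ),
        TransducerMoebiusEstimateSync k δ' M π l1 l2) :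
    mullner_moebius_automatic := by
  classical
  rw [mullner_moebius_automatic_iff_isLittleO]
  intro k hk a ha
  obtain ⟨σ, _, δ, q₀, τ, rfl⟩ := ha.exists_dfaoSeq hk
  rw [← dfaoSeq_optionLift k δ q₀ τ]
  exact isLittleO_moebiusSum_dfaoSeq_of_transducerEstimate hk (optionLiftδ δ q₀) none
    (optionLiftτ τ q₀) (optionLiftδ_none_zero δ q₀) (H k hk)

/-! ## Non-vacuity: the estimate holds when the transducer is trivial (`n₀ = 1`) -/

/-- **Consistency check / the synchronizing case through the general reduction**: if the
naturally induced transducer has rank `n₀ = 1` (equivalently the strongly connected automaton is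
synchronizing), its group is trivial, the condition `T(M, ·) = π` is void, and the transducer
estimate reduces to `μ` on an interval in a progression, which holds
(`exists_forall_norm_sum_Ico_residue_moebius_le`). [cite: Mullner2017, Prop. 3.2 (case n₀(A) = 1)] -/
theorem transducerMoebiusEstimate_of_minRank_eq_one {σ' : Type*} [Fintype σ'] [DecidableEq σ']
    {k : ℕ} (hk : 2 ≤ k) (δ' : σ' → ℕ → σ') (h1 : minRank δ' = 1) (M : MinImage δ')
    (π : Equiv.Perm (Fin (minRank δ'))) (l1 l2 : ℕ) : TransducerMoebiusEstimate k δ' M π l1 l2 := by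
  have hk0 : 0 < k := by omega
  haveI : Subsingleton (Equiv.Perm (Fin (minRank δ'))) := by
    rw [h1]; infer_instance
  intro ε hε
  obtain ⟨N₀, hN₀⟩ := exists_forall_norm_sum_Ico_residue_moebius_le (q := k ^ l2) (pow_pos hk0 _) hε
  refine ⟨N₀, fun N hN b m => ?_⟩
  set D := k ^ ((Nat.digits k N).length - l1) with hD
  have hDpos : 0 < D := pow_pos hk0 _
  have hfilter : ((range (N + 1)).filter fun n => n / D = b ∧ n % k ^ l2 = m ∧
      M.T (msbBlock k ((Nat.digits k N).length - l1) (n % D)) = π) =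
      ((range (N + 1)).filter fun n => n / D = b).filter fun n => n % k ^ l2 = m := by
    rw [filter_filter]
    refine filter_congr fun n _ => ?_
    simp only [Subsingleton.elim (M.T _ ) π, and_true]
  rw [hfilter, sum_filter, sum_filter_div_eq_eq_sum_Ico hDpos]
  have := hN₀ N hN m (b * D) (min ((b + 1) * D) (N + 1)) (min_le_right _ _)
  refine le_trans (le_of_eq ?_) this
  congr 1
  refine sum_congr rfl fun n _ => ?_
  split_ifs <;> simp

end Main

end Literature.NumberTheory.LFunctions
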